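import Summits.NavierStokesRegularity.FluidComputer.PalasekTowerHostLateFade
import Literature.Analysis.FluidPDE.TaoForcedBoundedTotalSpeed
import Literature.Analysis.FluidPDE.OseenHeatDuality
import Literature.Analysis.FluidPDE.OseenHeatWeakDiv
import Literature.Analysis.FluidPDE.ClayForceTimeShift

/-!
# The forced short-time sup bound REDUCED to a linear Oseen estimate, I: the pointwise Duhamel bound WITH force under a convective-pairing bound

Cell `ns-blowup`, seat `ns-blowup-ecbridge-1` (g6). LABEL: E–C typing / NEGATIVE-lane engine (kernel analysis
+ ONE named linear-analysis hypothesis). WHAT THIS IS NOT: not Navier–Stokes evidence — an a-priori estimate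
for GIVEN finite-energy classical solutions of the forced system, conditional on a linear estimate for the
Oseen tensor; nothing about blow-up.

`PalasekTowerHostLateFade.lean` §4 stated the engine hypothesis `Host.ForcedLerayShortTimeBound` (Leray's
short-time sup bound WITH a Clay force, a-priori form) under which the trap `FirstEpisode` is false
(`Theorems/EpisodeBase/Negative/FirstEpisodeHoldRelease.lean`). This file PROVES it from a strictly smaller,
purely LINEAR hypothesis `OseenConvectBound` (the `L¹`-type bound of the Oseen tensor: the convective
pairing of a bounded continuous `L²` field `a`, `|a| ≤ M`, against the Leray-projected heat kernel
`P(G_{ε+s}(·−x₀)e)` is `≤ C₁ s^{-1/2} M² ‖e‖`, uniformly in `ε`), by Tao's route for Prop. 9.1 WITH force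
(`TaoForcedBoundedTotalSpeed.lean`) with the Fourier majorant of the nonlinear term replaced by that bound:

* `enorm_inner_heatExtension_sub_le_of_bounded` — the regularised tested Duhamel formula WITH force
  (`IsLerayHopfOn.integral_inner_eq_mild_of_hasWeakGradient_forced` against `lerayHeatTest x₀ ε e`), the
  force term by the dispersive bound `eLpNorm_lerayHeatTest_le`, the convective term by `OseenConvectBound`;
* `enorm_sub_heatExtension_le_of_bounded` — `ε → 0⁺`:
  `‖u(t,x₀) − e^{νtΔ}u(0)(x₀)‖ ≤ C₁ M² ∫₀ᵗ (ν(t−τ))^{-1/2} dτ + C ∫₀ᵗ (ν(t−τ))^{-3/4} ‖f(τ)‖₂ dτ`;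
* `lintegral_rpow_neg_half_le`, `lintegral_rpow_neg_three_quarters_mul_le` — the two time integrals
  (`2ν^{-1/2}t^{1/2}`, `4ν^{-3/4}t^{1/4}F`);
* **`forcedLerayShortTimeBound_of_oseenConvectBound : OseenConvectBound → ForcedLerayShortTimeBound`** —
  time shift (`IsClassicalNSSolutionOn.comp_add_right`, `IsSmoothOnHalfSpace.timeShift`,
  `HasRapidSpaceTimeDecay.timeShift`), Leray–Hopf-ness of the classical solution
  (`isLerayHopfOn_of_finiteEnergy_forced_ae` with the PROVED `tao2011_forced_pressure_normalisation_ae_holds`,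
  `clayForce_slice_potential_bounds`, `clayForce_prod_aestronglyMeasurable/eLpNorm_lt_top`), the dispersive
  constant `exists_eLpNorm_top_heatExtension_le`, the heat `L^∞` bound `norm_heatExtension_le` for the free
  term, and `δ₀ = min(1, η/(K₁+K₂))⁴`: `|u(t,x)| ≤ A + (K₁ + K₂) δ₀^{1/4} ≤ A + η`.

ROUTE for `OseenConvectBound` (open here; all inputs in the tree): approximate `lerayHeatTest x₀ ε e` by
divergence-free test fields (`exists_isDivFree_test_approx`), use the duality
`integral_inner_sum_oseenHeat_tensor_eq_neg` (`OseenHeatDuality.lean`) with `heatExtension_lerayHeatTest`,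
pass to the limit, and evaluate the weakly divergence-free `L²` field `w = Σᵢ 𝒩_s(a⊗a)ᵢ bᵢ`
(`memLp_oseenHeat`, `isWeaklyDivFree_sum_oseenHeat_smul`) against `P(G_ε e)` by `integral_inner_lerayHeatTest`:
`|⟪e^{εΔ}w(x₀), e⟫| ≤ ‖w‖_∞‖e‖ ≤ C s^{-1/2} Σ‖aⱼaₖ‖_∞ ‖e‖` (`exists_enorm_oseenHeat_le_rpow`, `p = ⊤`;
`norm_heatExtension_le`).

References: T. Tao, Anal. PDE 6 (2013) = arXiv:1108.1165, Prop. 9.1, (9.2) [cite: Tao2011, Prop. 9.1 (proof, (9.2))];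
J. Leray, Acta Math. 63 (1934) §21 (3.15) [cite: Leray1934, §21 (3.15)]; P. G. Lemarié-Rieusset, CRC 2016,
Thm. 6.1 (6.11)–(6.12) [cite: LemarieRieusset2016, Thm. 6.1]; C. L. Fefferman, Clay problem description (5)(6)
[cite: FeffermanClay2006, (5) (6)].
-/

noncomputable section

open Set MeasureTheory Real Filter Topology
open scoped RealInnerProductSpace ENNReal NNReal

namespace Summit.NavierStokesRegularity.FluidComputer.PalasekTowerClayBridge.Host.Engine

open Literature.Analysis.FluidPDE Literature.Analysis.UnboundedOperators


/-- `‖v‖₂ ≤ A^{1/2}` from `∫|v|² ≤ A` (local copy of the private helper of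
`TaoForcedBoundedTotalSpeed`). [folklore] -/
theorem eLpNorm_two_le_rpow_half_of_lintegral_sq_le'
    {v : (EuclideanSpace ℝ (Fin 3)) → (EuclideanSpace ℝ (Fin 3))} {A : ℝ≥0∞} (h : ∫⁻ x, ‖v x‖ₑ ^ 2 ≤ A) : eLpNorm v 2 volume ≤ A ^ (1 / 2 : ℝ) := by
  have h2 : eLpNorm v 2 volume ^ 2 ≤ A := by
    rw [eLpNorm_two_sq_eq_lintegral]; exact h
  calc eLpNorm v 2 volume = (eLpNorm v 2 volume ^ 2) ^ (1 / 2 : ℝ) := by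
        rw [← ENNReal.rpow_natCast, ← ENNReal.rpow_mul]; norm_num
    _ ≤ A ^ (1 / 2 : ℝ) := ENNReal.rpow_le_rpow h2 (by norm_num)

section BC

variable {ν T : ℝ} {f u : ℝ → (EuclideanSpace ℝ (Fin 3)) → (EuclideanSpace ℝ (Fin 3))} {p : ℝ → (EuclideanSpace ℝ (Fin 3)) → ℝ}

/-- **Sub-lemma B (regularised Duhamel bound WITH force, physical convective bound)**: verbatim
`enorm_inner_heatExtension_sub_le_speedMajorant_forced` with the Fourier majorant of the nonlinear term
replaced by the bound of sub-lemma A (`|u| ≤ M` on the slab). -/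
theorem enorm_inner_heatExtension_sub_le_of_bounded (hν : 0 < ν) (hT : 0 < T)
    (hsol : IsClassicalNSSolutionOn (Icc 0 T) ν f u p) (hLH : IsLerayHopfOn T ν f (u 0) u)
    (hfm : AEStronglyMeasurable (Function.uncurry f)
      ((volume.restrict (Ioo 0 T)).prod (volume : Measure (EuclideanSpace ℝ (Fin 3)))))
    (hf2 : eLpNorm (Function.uncurry f) 2 ((volume.restrict (Ioo 0 T)).prod (volume : Measure (EuclideanSpace ℝ (Fin 3)))) < ⊤)
    (hfe : ∃ A : ℝ≥0∞, A < ⊤ ∧ ∀ t ∈ Icc 0 T, ∫⁻ x, ‖u t x‖ₑ ^ 2 ≤ A)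
    {M : ℝ} (hM : ∀ t ∈ Icc 0 T, ∀ x, ‖u t x‖ ≤ M)
    {C : ℝ≥0}
    (hC : ∀ (v : (EuclideanSpace ℝ (Fin 3)) → (EuclideanSpace ℝ (Fin 3))), MemLp v 2 volume → ∀ t : ℝ, 0 < t →
      eLpNorm (heatExtension v t) ∞ volume ≤ C * ENNReal.ofReal (t ^ (-(3 / 4 : ℝ))) * eLpNorm v 2 volume)
    {C₁ : ℝ≥0}
    (hC₁ : ∀ (x₀ e : (EuclideanSpace ℝ (Fin 3))) {ε s : ℝ}, 0 < ε → 0 < s →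
      ∀ {a : (EuclideanSpace ℝ (Fin 3)) → (EuclideanSpace ℝ (Fin 3))}, MemLp a 2 volume → Continuous a → ∀ {M : ℝ}, (∀ x, ‖a x‖ ≤ M) →
        ‖∫ x, ⟪a x, convect a (lerayHeatTest x₀ (ε + s) e) x⟫‖ₑ ≤
          C₁ * ENNReal.ofReal (s ^ (-(1 / 2 : ℝ))) * ENNReal.ofReal (M ^ 2) * ‖e‖ₑ)
    {t : ℝ} (ht : t ∈ Ioc 0 T) (x₀ e : (EuclideanSpace ℝ (Fin 3))) {ε : ℝ} (hε : 0 < ε) :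
    ‖⟪heatExtension (u t) ε x₀, e⟫ - ⟪heatExtension (u 0) (ε + ν * t) x₀, e⟫‖ₑ ≤
      ‖e‖ₑ * (C₁ * ENNReal.ofReal (M ^ 2) *
          (∫⁻ τ in Ioo 0 t, ENNReal.ofReal ((ν * (t - τ)) ^ (-(1 / 2 : ℝ)))) +
        C * ∫⁻ τ in Ioo 0 t, ENNReal.ofReal ((ν * (t - τ)) ^ (-(3 / 4 : ℝ))) *
          eLpNorm (f τ) 2 volume) := by
  obtain ⟨A, hAtop, hA⟩ := hfe
  have hL2 : ∀ s ∈ Icc 0 T, MemLp (u s) 2 volume := hLH.memLp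
  have h0T : (0 : ℝ) ∈ Icc 0 T := ⟨le_rfl, hT.le⟩
  have htT : t ∈ Icc 0 T := ⟨ht.1.le, ht.2⟩
  have hνt : 0 < ν * t := mul_pos hν ht.1
  have hdivt : IsWeaklyDivFree (u t) := hLH.isWeaklyDivFree_slice ht
  have hdiv0 : IsWeaklyDivFree (u 0) := hLH.isWeaklyDivFree_datum hT
  have hMA : ∀ s ∈ Icc 0 T, eLpNorm (u s) 2 volume ≤ A ^ (1 / 2 : ℝ) := fun s hs =>
    eLpNorm_two_le_rpow_half_of_lintegral_sq_le' (hA s hs)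
  have hMtop : A ^ (1 / 2 : ℝ) ≠ ⊤ := ENNReal.rpow_ne_top_of_nonneg (by norm_num) hAtop.ne
  -- the duality identity WITH force, `φ = P(G_ε(· - x₀) e)`
  have hid := hLH.integral_inner_eq_mild_of_hasWeakGradient_forced finrank_euclideanSpace_fin
    (hL2 0 h0T) hν hT hfm hf2 hMtop hMA (memLp_two_lerayHeatTest (x₀ := x₀) (e := e) hε)
    (isWeaklyDivFree_lerayHeatTest hε) (hasWeakGradient_lerayHeatTest hε)
    (lintegral_frobeniusNormSq_fderiv_lerayHeatTest_lt_top hε) ht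
  -- the caloric test field at elapsed time `ν s`
  have hfun : ∀ {s : ℝ}, 0 < s →
      heatTest ν (lerayHeatTest x₀ ε e) s = lerayHeatTest x₀ (ε + ν * s) e := by
    intro s hs
    rw [heatTest_of_pos hν hs]
    funext x
    exact heatExtension_lerayHeatTest hε (mul_pos hν hs) x
  -- the two linear terms
  have hlhs : ∫ x, ⟪u t x, lerayHeatTest x₀ ε e x⟫ = ⟪heatExtension (u t) ε x₀, e⟫ :=
    integral_inner_lerayHeatTest hε (hL2 t htT) hdivt
  have hfree : ∫ x, ⟪u 0 x, heatTest ν (lerayHeatTest x₀ ε e) t x⟫ =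
      ⟪heatExtension (u 0) (ε + ν * t) x₀, e⟫ := by
    rw [hfun ht.1]
    exact integral_inner_lerayHeatTest (add_pos hε hνt) (hL2 0 h0T) hdiv0
  -- the nonlinear term, pointwise in `τ ∈ (0, t)` and integrated — PHYSICAL bound
  set c : ℝ → ℝ := fun τ =>
    ∫ x, ⟪u τ x, convect (u τ) (heatTest ν (lerayHeatTest x₀ ε e) (t - τ)) x⟫ with hc
  have hcτ : ∀ τ ∈ Ioo 0 t, ‖c τ‖ₑ ≤ (C₁ * ENNReal.ofReal (M ^ 2) * ‖e‖ₑ) *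
      ENNReal.ofReal ((ν * (t - τ)) ^ (-(1 / 2 : ℝ))) := by
    intro τ hτ
    have hs : 0 < ν * (t - τ) := mul_pos hν (sub_pos.2 hτ.2)
    have hτT : τ ∈ Icc 0 T := ⟨hτ.1.le, (hτ.2.trans_le ht.2).le⟩
    simp only [hc, hfun (sub_pos.2 hτ.2)]
    have h := hC₁ x₀ e hε hs (hL2 τ hτT) (hsol.contDiff_velocity hτT).continuous (hM τ hτT)
    calc ‖∫ x, ⟪u τ x, convect (u τ) (lerayHeatTest x₀ (ε + ν * (t - τ)) e) x⟫‖ₑ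
        ≤ C₁ * ENNReal.ofReal ((ν * (t - τ)) ^ (-(1 / 2 : ℝ))) * ENNReal.ofReal (M ^ 2) * ‖e‖ₑ := h
      _ = (C₁ * ENNReal.ofReal (M ^ 2) * ‖e‖ₑ) * ENNReal.ofReal ((ν * (t - τ)) ^ (-(1 / 2 : ℝ))) := by
          ring
  have hNL : ‖∫ τ in Ioc 0 t, c τ‖ₑ ≤ (C₁ * ENNReal.ofReal (M ^ 2) * ‖e‖ₑ) *
      ∫⁻ τ in Ioo 0 t, ENNReal.ofReal ((ν * (t - τ)) ^ (-(1 / 2 : ℝ))) := by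
    calc ‖∫ τ in Ioc 0 t, c τ‖ₑ ≤ ∫⁻ τ in Ioc 0 t, ‖c τ‖ₑ := enorm_integral_le_lintegral_enorm _
      _ = ∫⁻ τ in Ioo 0 t, ‖c τ‖ₑ := setLIntegral_congr Ioo_ae_eq_Ioc.symm
      _ ≤ ∫⁻ τ in Ioo 0 t, (C₁ * ENNReal.ofReal (M ^ 2) * ‖e‖ₑ) *
            ENNReal.ofReal ((ν * (t - τ)) ^ (-(1 / 2 : ℝ))) :=
          setLIntegral_mono' measurableSet_Ioo hcτ
      _ = _ := lintegral_const_mul' _ _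
          (ENNReal.mul_ne_top (ENNReal.mul_ne_top ENNReal.coe_ne_top ENNReal.ofReal_ne_top) enorm_ne_top)
  -- the force term, pointwise in a.e. `τ ∈ (0, t)` and integrated (verbatim)
  set d : ℝ → ℝ := fun τ => ∫ x, ⟪f τ x, heatTest ν (lerayHeatTest x₀ ε e) (t - τ) x⟫ with hd
  have hfsl : ∀ᵐ τ ∂(volume.restrict (Ioo 0 t)), MemLp (f τ) 2 volume :=
    ae_mono (Measure.restrict_mono (Ioo_subset_Ioo le_rfl ht.2) le_rfl)
      (ae_memLp_two_slice_of_eLpNorm_prod hfm hf2)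
  have hdτ : ∀ᵐ τ ∂(volume.restrict (Ioo 0 t)), ‖d τ‖ₑ ≤ (C * ‖e‖ₑ) *
      (ENNReal.ofReal ((ν * (t - τ)) ^ (-(3 / 4 : ℝ))) * eLpNorm (f τ) 2 volume) := by
    filter_upwards [hfsl, ae_restrict_mem measurableSet_Ioo] with τ hfτ hτ
    have hs : 0 < ν * (t - τ) := mul_pos hν (sub_pos.2 hτ.2)
    simp only [hd, hfun (sub_pos.2 hτ.2)]
    calc ‖∫ x, ⟪f τ x, lerayHeatTest x₀ (ε + ν * (t - τ)) e x⟫‖ₑ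
        ≤ eLpNorm (f τ) 2 volume * eLpNorm (lerayHeatTest x₀ (ε + ν * (t - τ)) e) 2 volume :=
          Literature.Analysis.FunctionSpaces.enorm_integral_inner_le_eLpNorm_mul hfτ.1
            (memLp_two_lerayHeatTest (add_pos hε hs)).1
      _ ≤ eLpNorm (f τ) 2 volume *
            (C * ENNReal.ofReal ((ε + ν * (t - τ)) ^ (-(3 / 4 : ℝ))) * ‖e‖ₑ) :=
          mul_le_mul' le_rfl (eLpNorm_lerayHeatTest_le hC (add_pos hε hs))
      _ ≤ eLpNorm (f τ) 2 volume * (C * ENNReal.ofReal ((ν * (t - τ)) ^ (-(3 / 4 : ℝ))) * ‖e‖ₑ) := by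
          refine mul_le_mul' le_rfl (mul_le_mul' (mul_le_mul' le_rfl ?_) le_rfl)
          exact ENNReal.ofReal_le_ofReal
            (Real.rpow_le_rpow_of_nonpos hs (by linarith) (by norm_num))
      _ = (C * ‖e‖ₑ) * (ENNReal.ofReal ((ν * (t - τ)) ^ (-(3 / 4 : ℝ))) * eLpNorm (f τ) 2 volume) := by
          ring
  have hF : ‖∫ τ in Ioc 0 t, d τ‖ₑ ≤ (C * ‖e‖ₑ) *
      ∫⁻ τ in Ioo 0 t, ENNReal.ofReal ((ν * (t - τ)) ^ (-(3 / 4 : ℝ))) * eLpNorm (f τ) 2 volume := by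
    calc ‖∫ τ in Ioc 0 t, d τ‖ₑ ≤ ∫⁻ τ in Ioc 0 t, ‖d τ‖ₑ := enorm_integral_le_lintegral_enorm _
      _ = ∫⁻ τ in Ioo 0 t, ‖d τ‖ₑ := setLIntegral_congr Ioo_ae_eq_Ioc.symm
      _ ≤ ∫⁻ τ in Ioo 0 t, (C * ‖e‖ₑ) *
            (ENNReal.ofReal ((ν * (t - τ)) ^ (-(3 / 4 : ℝ))) * eLpNorm (f τ) 2 volume) :=
          lintegral_mono_ae hdτ
      _ = _ := lintegral_const_mul' _ _ (ENNReal.mul_ne_top ENNReal.coe_ne_top enorm_ne_top)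
  -- assemble
  have hkey : ⟪heatExtension (u t) ε x₀, e⟫ - ⟪heatExtension (u 0) (ε + ν * t) x₀, e⟫ =
      (∫ τ in Ioc 0 t, c τ) + ∫ τ in Ioc 0 t, d τ := by
    rw [← hlhs, ← hfree, hid]
    ring
  rw [hkey]
  calc ‖(∫ τ in Ioc 0 t, c τ) + ∫ τ in Ioc 0 t, d τ‖ₑ
      ≤ ‖∫ τ in Ioc 0 t, c τ‖ₑ + ‖∫ τ in Ioc 0 t, d τ‖ₑ := enorm_add_le _ _
    _ ≤ _ := add_le_add hNL hF
    _ = _ := by ring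

/-- **Sub-lemma C (`ε → 0⁺`)**: the pointwise Duhamel bound WITH force for a forced Leray–Hopf
classical solution bounded by `M` (verbatim `enorm_sub_heatExtension_le_speedMajorant_forced` on B). -/
theorem enorm_sub_heatExtension_le_of_bounded (hν : 0 < ν) (hT : 0 < T)
    (hsol : IsClassicalNSSolutionOn (Icc 0 T) ν f u p) (hLH : IsLerayHopfOn T ν f (u 0) u)
    (hfm : AEStronglyMeasurable (Function.uncurry f)
      ((volume.restrict (Ioo 0 T)).prod (volume : Measure (EuclideanSpace ℝ (Fin 3)))))
    (hf2 : eLpNorm (Function.uncurry f) 2 ((volume.restrict (Ioo 0 T)).prod (volume : Measure (EuclideanSpace ℝ (Fin 3)))) < ⊤)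
    (hfe : ∃ A : ℝ≥0∞, A < ⊤ ∧ ∀ t ∈ Icc 0 T, ∫⁻ x, ‖u t x‖ₑ ^ 2 ≤ A)
    {M : ℝ} (hM : ∀ t ∈ Icc 0 T, ∀ x, ‖u t x‖ ≤ M)
    {C : ℝ≥0}
    (hC : ∀ (v : (EuclideanSpace ℝ (Fin 3)) → (EuclideanSpace ℝ (Fin 3))), MemLp v 2 volume → ∀ t : ℝ, 0 < t →
      eLpNorm (heatExtension v t) ∞ volume ≤ C * ENNReal.ofReal (t ^ (-(3 / 4 : ℝ))) * eLpNorm v 2 volume)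
    {C₁ : ℝ≥0}
    (hC₁ : ∀ (x₀ e : (EuclideanSpace ℝ (Fin 3))) {ε s : ℝ}, 0 < ε → 0 < s →
      ∀ {a : (EuclideanSpace ℝ (Fin 3)) → (EuclideanSpace ℝ (Fin 3))}, MemLp a 2 volume → Continuous a → ∀ {M : ℝ}, (∀ x, ‖a x‖ ≤ M) →
        ‖∫ x, ⟪a x, convect a (lerayHeatTest x₀ (ε + s) e) x⟫‖ₑ ≤
          C₁ * ENNReal.ofReal (s ^ (-(1 / 2 : ℝ))) * ENNReal.ofReal (M ^ 2) * ‖e‖ₑ)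
    {t : ℝ} (ht : t ∈ Ioc 0 T) (x₀ : (EuclideanSpace ℝ (Fin 3))) :
    ‖u t x₀ - heatExtension (u 0) (ν * t) x₀‖ₑ ≤
      C₁ * ENNReal.ofReal (M ^ 2) * (∫⁻ τ in Ioo 0 t, ENNReal.ofReal ((ν * (t - τ)) ^ (-(1 / 2 : ℝ)))) +
        C * ∫⁻ τ in Ioo 0 t, ENNReal.ofReal ((ν * (t - τ)) ^ (-(3 / 4 : ℝ))) * eLpNorm (f τ) 2 volume := by
  set B : ℝ≥0∞ := C₁ * ENNReal.ofReal (M ^ 2) *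
      (∫⁻ τ in Ioo 0 t, ENNReal.ofReal ((ν * (t - τ)) ^ (-(1 / 2 : ℝ)))) +
        C * ∫⁻ τ in Ioo 0 t, ENNReal.ofReal ((ν * (t - τ)) ^ (-(3 / 4 : ℝ))) * eLpNorm (f τ) 2 volume
    with hB
  rcases eq_or_lt_of_le (le_top : B ≤ ⊤) with hBtop | hBtop
  · rw [hBtop]; exact le_top
  have hL2 : ∀ s ∈ Icc 0 T, MemLp (u s) 2 volume := hLH.memLp
  have h0T : (0 : ℝ) ∈ Icc 0 T := ⟨le_rfl, hT.le⟩
  have htT : t ∈ Icc 0 T := ⟨ht.1.le, ht.2⟩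
  have hνt : 0 < ν * t := mul_pos hν ht.1
  set w : (EuclideanSpace ℝ (Fin 3)) := u t x₀ - heatExtension (u 0) (ν * t) x₀ with hw
  have hreg : ∀ e : (EuclideanSpace ℝ (Fin 3)), ∀ ε : ℝ, 0 < ε →
      |⟪heatExtension (u t) ε x₀, e⟫ - ⟪heatExtension (u 0) (ε + ν * t) x₀, e⟫| ≤ ‖e‖ * B.toReal := by
    intro e ε hε
    have h := enorm_inner_heatExtension_sub_le_of_bounded hν hT hsol hLH hfm hf2 hfe hM hC hC₁ ht x₀ e hε
    rw [← hB] at h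
    have h2 : ‖⟪heatExtension (u t) ε x₀, e⟫ - ⟪heatExtension (u 0) (ε + ν * t) x₀, e⟫‖ₑ ≤
        ENNReal.ofReal (‖e‖ * B.toReal) := by
      rwa [ENNReal.ofReal_mul (norm_nonneg _), ofReal_norm, ENNReal.ofReal_toReal hBtop.ne]
    rw [← ofReal_norm, ENNReal.ofReal_le_ofReal_iff (by positivity), Real.norm_eq_abs] at h2
    exact h2
  have hlim1 : Tendsto (fun ε : ℝ => heatExtension (u t) ε x₀) (𝓝[>] 0) (𝓝 (u t x₀)) :=
    tendsto_heatExtension_nhdsGT_zero_of_continuousAt (hL2 t htT) one_le_two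
      (hsol.contDiff_velocity htT).continuous.continuousAt
  have hlim2 : Tendsto (fun ε : ℝ => heatExtension (u 0) (ε + ν * t) x₀) (𝓝[>] 0)
      (𝓝 (heatExtension (u 0) (ν * t) x₀)) := by
    have hcont : ContinuousAt (fun σ : ℝ => heatExtension (u 0) σ x₀) (ν * t) :=
      (continuousOn_heatExtension_time (hL2 0 h0T) one_le_two x₀).continuousAt (Ioi_mem_nhds hνt)
    have hadd : Tendsto (fun ε : ℝ => ε + ν * t) (𝓝[>] 0) (𝓝 (ν * t)) := by
      have h : Tendsto (fun ε : ℝ => ε + ν * t) (𝓝 0) (𝓝 (0 + ν * t)) :=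
        (continuous_id.add continuous_const).tendsto 0
      rw [zero_add] at h
      exact h.mono_left nhdsWithin_le_nhds
    exact hcont.tendsto.comp hadd
  have hbound : ∀ e : (EuclideanSpace ℝ (Fin 3)), |⟪w, e⟫| ≤ ‖e‖ * B.toReal := by
    intro e
    have hT' : Tendsto (fun ε : ℝ => |⟪heatExtension (u t) ε x₀, e⟫ -
        ⟪heatExtension (u 0) (ε + ν * t) x₀, e⟫|) (𝓝[>] 0) (𝓝 |⟪w, e⟫|) := by
      have h : Tendsto (fun ε : ℝ => |⟪heatExtension (u t) ε x₀, e⟫ -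
          ⟪heatExtension (u 0) (ε + ν * t) x₀, e⟫|) (𝓝[>] 0)
          (𝓝 |⟪u t x₀, e⟫ - ⟪heatExtension (u 0) (ν * t) x₀, e⟫|) :=
        ((hlim1.inner (𝕜 := ℝ) (tendsto_const_nhds (x := e))).sub
          (hlim2.inner (𝕜 := ℝ) (tendsto_const_nhds (x := e)))).abs
      rw [hw, inner_sub_left]
      exact h
    exact le_of_tendsto hT' (eventually_nhdsWithin_of_forall fun ε hε => hreg e ε hε)
  have hnorm : ‖w‖ ≤ B.toReal := by
    have h := hbound w
    rw [real_inner_self_eq_norm_sq, abs_of_nonneg (sq_nonneg _), sq] at h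
    rcases eq_or_lt_of_le (norm_nonneg w) with h0 | hpos
    · rw [← h0]; exact ENNReal.toReal_nonneg
    · exact le_of_mul_le_mul_right (by linarith [h]) hpos
  calc ‖w‖ₑ = ENNReal.ofReal ‖w‖ := (ofReal_norm w).symm
    _ ≤ ENNReal.ofReal B.toReal := ENNReal.ofReal_le_ofReal hnorm
    _ = B := ENNReal.ofReal_toReal hBtop.ne

end BC

end Summit.NavierStokesRegularity.FluidComputer.PalasekTowerClayBridge.Host.Engine

end
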